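import Summits.ResolutionOfSingularities.ResolutionOfSingularities.Theorems.EquisingularLiftEquisingularLiftNatEquinodalChartFrameDerivations
import Summits.ResolutionOfSingularities.ResolutionOfSingularities.Theorems.EquisingularLiftEquisingularLiftNatEquinodalNodeChartStalk
import Summits.ResolutionOfSingularities.ResolutionOfSingularities.Theorems.EquisingularLiftEquisingularLiftNatEquinodalNodeChart
import Summits.ResolutionOfSingularities.ResolutionOfSingularities.Theorems.EquisingularLiftEquisingularLiftNatEquinodalNodeRegularCore
import Summits.ResolutionOfSingularities.ResolutionOfSingularities.Theorems.EquisingularLiftEquisingularLiftNatCompleteIntersectionLiftProj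
import Summits.ResolutionOfSingularities.ResolutionOfSingularities.Theorems.EquisingularLiftEquisingularLiftNatNoseTraceTools
import Literature.AlgebraicGeometry.Resolution.AlterationsSections
import Literature.AlgebraicGeometry.Resolution.StalkSpecializesLocalization
import Literature.AlgebraicGeometry.Resolution.PrimeDivisorIdeals
import Summits.ResolutionOfSingularities.ResolutionOfSingularities.Theorems.EquisingularLiftEquisingularLiftNatEquinodalRegularPairOfDerivations
import HarnessLib

/-!
# [OURS · L1 W4.5(b) · EL♮(3) · door ν4, N-0 core W5, piece W5b] ★ `nose_regular_near_node` —
# THE NOSE MODEL `V(𝓦₀)` IS REGULAR AT EVERY POINT NEAR A NODE SECTION AND OFF IT (generic fibre included)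

res-L1-w45b-stub-2 g18 (W5b pen of record, desk g25-13; binder of record `g18/W5b-binder.txt` be648d6fc3957fb4). `--supports
stmt-ResolutionOfSingularities-20148 --as helper`, no claim, counted 0. OURS; NOT a statement of [Hironaka2017]; AI-written, weaker than expert review.
EL♮(3) is NOT proved here; char-p resolution is NOT proved anywhere in this tree. DEF-FREE.

STATEMENT.  Binders = the `cores` binder list of ✓ `coreS_of_cores₂` (…NatEquinodalCoreSOfCores2 l.45–88) VERBATIM, then: for every node section `𝔰 i` and
every point `x` of `V(𝓦₀)` whose image `y ∈ ℙ³_O` specialises to the node `𝔰 i (𝔪)` and is NOT on `𝔰 i`, `𝒪_{V(𝓦₀),x}` is a regular local ring.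
PROOF (route A′: ambient chart + derivations).  At the node `x₀ = 𝔰 i (𝔪) ∈ D₊(x_d)` the stalks of `ker 𝔰ᵢ`, `𝓦₀` are `(ℓ, u, v)`, `(ℓ, g)` with
`ℓ, u, v, g` the germs of the dehomogenised frame and of `Ĝ/x_d^e`, and `g = a u² + b uv + c v² + h`, `h ∈ (u,v)³`, `b² − 4ac` a unit — replayed from
res-L1-w45b-stub-4's ✓ `coreS8_splitNode` (its dictionary ✓ `stalkIdeal_ker_sectionOfVec_eq`, ✓ `span_X_sub_eq_span_frame`, ✓ `node_taylor_eval₂`, ✓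
`CILift.stalkIdeal_projIdealSheaf_span`).  `𝒪_{P,y}` is the localisation of `𝒪_{P,x₀}` at `𝔭 = sp⁻¹ 𝔪_y` (Literature `isLocalizationAtPrime_stalkSpecializes`),
the stalks at `y` are the extended ones (Literature `stalkIdeal_map_stalkSpecializes`), and `y ∉ range 𝔰ᵢ = supp (ker 𝔰ᵢ)` gives `¬(u, v ∈ 𝔭)`.  The frame's
DUAL DERIVATIONS (part 1 ✓ `exists_chart_frame_dual_derivations`) extend to `𝒪_{P,x₀}` (Mathlib `IsAffineOpen.isLocalization_stalk` + `Proj.basicOpenIsoAway`);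
res-L1-w45b-nose-w1's ✓ `NodeReg.node_deriv_not_mem` (Nakayama at the node) gives `δ₂ g ∉ 𝔭 ∨ δ₃ g ∉ 𝔭`, and with `δ₁ ℓ = 1`, `δ₂ ℓ = δ₃ ℓ = 0` res-type-027's
RANK-2 JACOBIAN criterion ✓ `NodeReg.isRegularLocalRing_quotient_pair_of_derivations` makes `𝒪_{P,y} ⧸ (ℓ, g) = 𝒪_{P,y} ⧸ (𝓦₀)_y ≅ 𝒪_{V(𝓦₀),x}` regular.

References: [cite: Matsumura1987, Thm. 14.2, §30] [cite: Hartshorne1977, II Prop. 5.9].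
-/

set_option linter.dupNamespace false
set_option linter.overlappingInstances false -- signatures carry `[IsDomain O] [IsDiscreteValuationRing O]` (as ✓ coreS_of_cores₂)

noncomputable section

open CategoryTheory CategoryTheory.Limits AlgebraicGeometry TopologicalSpace Topology IsLocalRing
open MvPolynomial HomogeneousLocalization
open Literature.AlgebraicGeometry.Resolution
open AlgebraicGeometry.Scheme.IdealSheafData
open Summit.ResolutionOfSingularities.ResolutionOfSingularities.Theses.EquisingularLift.Split
open Summit.ResolutionOfSingularities.ResolutionOfSingularities.Cruxes.EquisingularLift.StrataSplit

namespace Summit.ResolutionOfSingularities.ResolutionOfSingularities.Cruxes.EquisingularLiftNat.Sections.Equinodal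

open Summit.ResolutionOfSingularities.ResolutionOfSingularities.Cruxes.EquisingularLiftNat.Sections

set_option maxHeartbeats 6000000 in -- budget line: the `cores₂` binder list (55 lines) makes every `whnf` of the goal expensive
/-- ★ **W5b — `V(𝓦₀)` is regular at every point near a node section and off it.**  Binders = the `cores` binder list of ✓ `coreS_of_cores₂`
VERBATIM; conclusion = the W5b binder of record (be648d6fc3957fb4).  See the module docstring for the proof. [cite: Matsumura1987, Thm. 14.2]
[OURS · L1 W4.5b · N-0 core W5, piece W5b; counted 0] -/
theorem nose_regular_near_node (k : Type) [Field k] [IsAlgClosed k] :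
    ∀ (O : Type) [CommRing O] [IsDomain O] [IsDiscreteValuationRing O] [IsAdicComplete (IsLocalRing.maximalIdeal O) O]
        [IsAlgClosed (IsLocalRing.ResidueField O)] (θ : O →+* k), Function.Surjective θ →
      (letI := MvPolynomial.gradedAlgebra (σ := Fin (3 + 1)) (R := O); letI := MvPolynomial.gradedAlgebra (σ := Fin (3 + 1)) (R := k);
       ∀ (φ : MvPolynomial.homogeneousSubmodule (Fin (3 + 1)) O →+*ᵍ MvPolynomial.homogeneousSubmodule (Fin (3 + 1)) k)
        (hφ' : HomogeneousIdeal.irrelevant (MvPolynomial.homogeneousSubmodule (Fin (3 + 1)) k) ≤ (HomogeneousIdeal.irrelevant (MvPolynomial.homogeneousSubmodule (Fin (3 + 1)) O)).map φ), (∀ s, φ s = MvPolynomial.map θ s) →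
        AlgebraicGeometry.IsIntegral (AlgebraicGeometry.Proj (MvPolynomial.homogeneousSubmodule (Fin (3 + 1)) O)) → IsLocallyNoetherian (AlgebraicGeometry.Proj (MvPolynomial.homogeneousSubmodule (Fin (3 + 1)) O)) → Literature.AlgebraicGeometry.Resolution.Scheme.IsRegular (AlgebraicGeometry.Proj (MvPolynomial.homogeneousSubmodule (Fin (3 + 1)) O)) → AlgebraicGeometry.IsProper (AlgebraicGeometry.Proj.toSpecZero (MvPolynomial.homogeneousSubmodule (Fin (3 + 1)) O) ≫ AlgebraicGeometry.Spec.map (CommRingCat.ofHom (algebraMap O (MvPolynomial.homogeneousSubmodule (Fin (3 + 1)) O 0)))) → AlgebraicGeometry.SmoothOfRelativeDimension 3 (AlgebraicGeometry.Proj.toSpecZero (MvPolynomial.homogeneousSubmodule (Fin (3 + 1)) O) ≫ AlgebraicGeometry.Spec.map (CommRingCat.ofHom (algebraMap O (MvPolynomial.homogeneousSubmodule (Fin (3 + 1)) O 0)))) →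
      -- the door's `ℓ`, `Z` and the CERTIFICATE data (`EqCertAt₀ k 3 ℓ Z hZ` unpacked)
      ∀ (ℓ : MvPolynomial (Fin (3 + 1)) k) (Z : Set (Literature.AlgebraicGeometry.Motives.projectiveSpace 3 k).left) (hZ : IsClosed Z) (e δ : ℕ) (g : MvPolynomial (Fin (3 + 1)) k)
        (B : Fin (3 + 1) → Fin 3 → k) (c a b : Fin 3) (v : Fin δ → Fin 3 → k) (r : Fin 3 → Fin (3 + 1)),
        g.IsHomogeneous e → Squarefree (restrictToHyperplane B g) →
        Z = {y : (Literature.AlgebraicGeometry.Motives.projectiveSpace 3 k).left | ℓ ∈ (y : ProjectiveSpectrum (MvPolynomial.homogeneousSubmodule (Fin (3 + 1)) k)).asHomogeneousIdeal ∧ g ∈ (y : ProjectiveSpectrum (MvPolynomial.homogeneousSubmodule (Fin (3 + 1)) k)).asHomogeneousIdeal} →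
        restrictToHyperplane B ℓ = 0 → Function.Injective r → ((c : ℕ) = 2 ∧ (a : ℕ) = 0 ∧ (b : ℕ) = 1) →
        (∀ i, v i c = 1 ∧ MvPolynomial.eval (v i) (restrictToHyperplane B g) = 0 ∧
          (∀ j, MvPolynomial.eval (v i) (MvPolynomial.pderiv j (restrictToHyperplane B g)) = 0) ∧ hessBlock (restrictToHyperplane B g) a b (v i) ≠ 0) →
        (∀ z : ↥(redSub (Literature.AlgebraicGeometry.Motives.projectiveSpace 3 k).left Z hZ), IsClosed ({z} : Set ↥(redSub (Literature.AlgebraicGeometry.Motives.projectiveSpace 3 k).left Z hZ)) → ¬ IsRegularLocalRing ((redSub (Literature.AlgebraicGeometry.Motives.projectiveSpace 3 k).left Z hZ).presheaf.stalk z) →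
          ∃ i, IsCoordVecOf k 3 (fun s => ∑ j, B s j * v i j) (redSubι (Literature.AlgebraicGeometry.Motives.projectiveSpace 3 k).left Z hZ z : (Literature.AlgebraicGeometry.Motives.projectiveSpace 3 k).left)) →
        Function.Injective v →
      -- the LIFTED HYPERPLANE data (✓ `HyperplaneLift.exists_hyperplane_lift`)
      ∀ (a₀ : Fin (3 + 1)) (Bt : Fin (3 + 1) → Fin 3 → O) (ct : Fin (3 + 1) → O) (Nt : Fin 3 → Fin 3 → O),
        (∀ j, r j ≠ a₀) → (∀ a' j, θ (Bt a' j) = B a' j) → IsUnit (Matrix.of fun j j' : Fin 3 => Bt (r j) j').det → ct a₀ = 1 →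
        MvPolynomial.aeval (fun a' : Fin (3 + 1) => ∑ j : Fin 3, MvPolynomial.C (Bt a' j) * MvPolynomial.X j) (∑ a, MvPolynomial.C (ct a) * MvPolynomial.X a : MvPolynomial (Fin (3 + 1)) O) = 0 →
        (∀ G : MvPolynomial (Fin 3) O, MvPolynomial.aeval (fun a' : Fin (3 + 1) => ∑ j : Fin 3, MvPolynomial.C (Bt a' j) * MvPolynomial.X j)
          (MvPolynomial.aeval (fun i : Fin 3 => ∑ j : Fin 3, MvPolynomial.C (Nt i j) * MvPolynomial.X (r j)) G) = G) →
        (∀ f : MvPolynomial (Fin (3 + 1)) O, MvPolynomial.aeval (fun a' : Fin (3 + 1) => ∑ j : Fin 3, MvPolynomial.C (Bt a' j) * MvPolynomial.X j) f = 0 → (∑ a, MvPolynomial.C (ct a) * MvPolynomial.X a : MvPolynomial (Fin (3 + 1)) O) ∣ f) →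
        {y : (Literature.AlgebraicGeometry.Motives.projectiveSpace 3 k).left | ℓ ∈ (y : ProjectiveSpectrum (MvPolynomial.homogeneousSubmodule (Fin (3 + 1)) k)).asHomogeneousIdeal} = {y : (Literature.AlgebraicGeometry.Motives.projectiveSpace 3 k).left | (∑ a', MvPolynomial.C (θ (ct a')) * MvPolynomial.X a' : MvPolynomial (Fin (3 + 1)) k) ∈ (y : ProjectiveSpectrum (MvPolynomial.homogeneousSubmodule (Fin (3 + 1)) k)).asHomogeneousIdeal} →
      -- the EQUINODAL LIFT (✓ `exists_equinodal_lift_of_cert_of_surjective`)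
      ∀ (Gt : MvPolynomial (Fin 3) O) (nO : Fin δ → Fin 3 → O),
        Gt.IsHomogeneous e → MvPolynomial.map θ Gt = restrictToHyperplane B g → (∀ i j, θ (nO i j) = v i j) → (∀ i, nO i 2 = 1) →
        (∀ i, MvPolynomial.eval (nO i) Gt = 0 ∧ ∀ j, MvPolynomial.eval (nO i) (MvPolynomial.pderiv j Gt) = 0) →
        (∀ i, IsUnit (MvPolynomial.eval (nO i) (MvPolynomial.pderiv 0 (MvPolynomial.pderiv 0 Gt)) * MvPolynomial.eval (nO i) (MvPolynomial.pderiv 1 (MvPolynomial.pderiv 1 Gt))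
          - MvPolynomial.eval (nO i) (MvPolynomial.pderiv 0 (MvPolynomial.pderiv 1 Gt)) ^ 2)) →
      -- the two models' degree certificates (so the ideal sheaves below are well-formed)
      ∀ (hL : ∀ l, (![(∑ a, MvPolynomial.C (ct a) * MvPolynomial.X a : MvPolynomial (Fin (3 + 1)) O)] : Fin 1 → MvPolynomial (Fin (3 + 1)) O) l ∈ MvPolynomial.homogeneousSubmodule (Fin (3 + 1)) O ((![1] : Fin 1 → ℕ) l))
        (hF : ∀ l, (![(∑ a, MvPolynomial.C (ct a) * MvPolynomial.X a : MvPolynomial (Fin (3 + 1)) O), (MvPolynomial.aeval (fun i : Fin 3 => ∑ j : Fin 3, MvPolynomial.C (Nt i j) * MvPolynomial.X (r j)) Gt : MvPolynomial (Fin (3 + 1)) O)] : Fin 2 → MvPolynomial (Fin (3 + 1)) O) l ∈ MvPolynomial.homogeneousSubmodule (Fin (3 + 1)) O ((![1, e] : Fin 2 → ℕ) l)),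
      -- the NODE SECTIONS `𝔰 i = [av i]`, `av i = uᵢ⁻¹ • B̃·nO i` (✓ SectionOfVec), and the marked closed points `w i`
      ∀ (av : Fin δ → Fin (3 + 1) → O) (dv : Fin δ → Fin (3 + 1)) (hav : ∀ i, av i (dv i) = 1),
        (∀ i, ∃ u : O, IsUnit u ∧ ∀ a', u * av i a' = ∑ j : Fin 3, Bt a' j * nO i j) →
      ∀ (𝔰 : Fin δ → (AlgebraicGeometry.Spec (.of O) ⟶ (AlgebraicGeometry.Proj (MvPolynomial.homogeneousSubmodule (Fin (3 + 1)) O)))),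
        (∀ i, 𝔰 i = (AlgebraicGeometry.Spec.map (CommRingCat.ofHom ((Localization.awayLift (MvPolynomial.eval (av i)) (MvPolynomial.X (dv i) : MvPolynomial (Fin (3 + 1)) O)
            (SectionOfVec.isUnit_eval_X (av i) (dv i) (hav i))).comp
          (algebraMap (HomogeneousLocalization.Away (MvPolynomial.homogeneousSubmodule (Fin (3 + 1)) O) (MvPolynomial.X (dv i) : MvPolynomial (Fin (3 + 1)) O))
            (Localization.Away (MvPolynomial.X (dv i) : MvPolynomial (Fin (3 + 1)) O))))) ≫
          AlgebraicGeometry.Proj.awayι (MvPolynomial.homogeneousSubmodule (Fin (3 + 1)) O) (MvPolynomial.X (dv i)) (MvPolynomial.isHomogeneous_X O (dv i)) one_pos)) →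
      ∀ (w : Fin δ → (Literature.AlgebraicGeometry.Motives.projectiveSpace 3 k).left), (∀ i, (AlgebraicGeometry.Proj.map φ hφ' : (Literature.AlgebraicGeometry.Motives.projectiveSpace 3 k).left ⟶ (AlgebraicGeometry.Proj (MvPolynomial.homogeneousSubmodule (Fin (3 + 1)) O))) (w i) = 𝔰 i (IsLocalRing.closedPoint O)) →
      ∀ (i : Fin δ) (x : ↥((projIdealSheaf (MvPolynomial.homogeneousSubmodule (Fin (3 + 1)) O) ⟨Ideal.span (Set.range ![(∑ a, MvPolynomial.C (ct a) * MvPolynomial.X a : MvPolynomial (Fin (3 + 1)) O), (MvPolynomial.aeval (fun i : Fin 3 => ∑ j : Fin 3, MvPolynomial.C (Nt i j) * MvPolynomial.X (r j)) Gt : MvPolynomial (Fin (3 + 1)) O)]), isHomogeneous_span_of_forall_mem _ _ _ hF⟩).subscheme)), (projIdealSheaf (MvPolynomial.homogeneousSubmodule (Fin (3 + 1)) O) ⟨Ideal.span (Set.range ![(∑ a, MvPolynomial.C (ct a) * MvPolynomial.X a : MvPolynomial (Fin (3 + 1)) O), (MvPolynomial.aeval (fun i : Fin 3 => ∑ j :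 Fin 3, MvPolynomial.C (Nt i j) * MvPolynomial.X (r j)) Gt : MvPolynomial (Fin (3 + 1)) O)]), isHomogeneous_span_of_forall_mem _ _ _ hF⟩).subschemeι x ⤳ 𝔰 i (IsLocalRing.closedPoint O) →
          (projIdealSheaf (MvPolynomial.homogeneousSubmodule (Fin (3 + 1)) O) ⟨Ideal.span (Set.range ![(∑ a, MvPolynomial.C (ct a) * MvPolynomial.X a : MvPolynomial (Fin (3 + 1)) O), (MvPolynomial.aeval (fun i : Fin 3 => ∑ j : Fin 3, MvPolynomial.C (Nt i j) * MvPolynomial.X (r j)) Gt : MvPolynomial (Fin (3 + 1)) O)]), isHomogeneous_span_of_forall_mem _ _ _ hF⟩).subschemeι x ∉ Set.range (𝔰 i) → IsRegularLocalRing ((projIdealSheaf (MvPolynomial.homogeneousSubmodule (Fin (3 + 1)) O) ⟨Ideal.span (Set.range ![(∑ a, MvPolynomial.C (ct a) * MvPolynomial.X a : MvPolynomial (Fin (3 + 1)) O), (MvPolynomial.aeval (fun i : Fin 3 => ∑ j : Fin 3, MvPolynomial.C (Nt i j) * MvPolynomial.X (r j)) Gt : MvPolynomial (Fin (3 + 1))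 O)]), isHomogeneous_span_of_forall_mem _ _ _ hF⟩).subscheme.presheaf.stalk x)) := by
  intro O _ _ _ _ _ θ hθ
  letI := MvPolynomial.gradedAlgebra (σ := Fin (3 + 1)) (R := O)
  letI := MvPolynomial.gradedAlgebra (σ := Fin (3 + 1)) (R := k)
  intro φ hφ' hφ hPint hPnoeth hPreg hqprop hqsm ℓ Z hZ e δ g B c a b v r hg hsqf hZeq hℓB hr hcab hmarked hcover hvinj a₀ Bt ct Nt ha₀ hBt
    hdet hcta₀ hψt hsect hkert hVℓ Gt nO hGt hGtred hnOv hnO2 hnode hhess hL hF av dv hav hunit 𝔰 h𝔰 w hw i x hsp hoff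
  classical
  letI := Literature.AlgebraicGeometry.Motives.ProjBaseChange.algebraBase (R := O) (MvPolynomial.homogeneousSubmodule (Fin (3 + 1)) O)
    (Submonoid.powers (X (dv i) : MvPolynomial (Fin (3 + 1)) O))
  obtain ⟨u₀, hu₀, huav⟩ := hunit i
  rw [h𝔰 i] at hsp hoff
  -- names: the section, its closed point, the chart, the germ map `Θ` (as in ✓ `coreS8_splitNode`)
  set S := Spec.map (CommRingCat.ofHom ((Localization.awayLift (MvPolynomial.eval (av i)) (MvPolynomial.X (dv i) : MvPolynomial (Fin (3 + 1)) O)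
      (SectionOfVec.isUnit_eval_X (av i) (dv i) (hav i))).comp
      (algebraMap (HomogeneousLocalization.Away (MvPolynomial.homogeneousSubmodule (Fin (3 + 1)) O) (MvPolynomial.X (dv i) : MvPolynomial (Fin (3 + 1)) O))
        (Localization.Away (MvPolynomial.X (dv i) : MvPolynomial (Fin (3 + 1)) O))))) ≫
    AlgebraicGeometry.Proj.awayι (MvPolynomial.homogeneousSubmodule (Fin (3 + 1)) O) (MvPolynomial.X (dv i)) (MvPolynomial.isHomogeneous_X O (dv i)) one_pos
    with hSdef
  set p := IsLocalRing.closedPoint O with hp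
  set U := Proj.basicOpen (homogeneousSubmodule (Fin (3 + 1)) O) (X (dv i) : MvPolynomial (Fin (3 + 1)) O) with hU
  have hx : S p ∈ U := SectionOfVec.sectionOfVec_mem_basicOpen (av i) (dv i) (hav i) p
  haveI := hqprop
  haveI hci : IsClosedImmersion S :=
    Literature.AlgebraicGeometry.Resolution.DeJong1996.IsUnionOfSections.isClosedImmersion_of_comp_eq_id
      (SectionOfVec.sectionOfVec_comp_eq_id (av i) (dv i) (hav i))
  set Θ : HomogeneousLocalization.Away (homogeneousSubmodule (Fin (3 + 1)) O) (X (dv i) : MvPolynomial (Fin (3 + 1)) O) →+*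
      (Proj (homogeneousSubmodule (Fin (3 + 1)) O)).presheaf.stalk (S p) :=
    ((Proj (homogeneousSubmodule (Fin (3 + 1)) O)).presheaf.germ U (S p) hx).hom.comp
      (Proj.awayToSection (homogeneousSubmodule (Fin (3 + 1)) O) (X (dv i) : MvPolynomial (Fin (3 + 1)) O)).hom with hΘ
  -- the linear forms and the key form
  set Lt : MvPolynomial (Fin (3 + 1)) O := ∑ a, C (ct a) * X a with hLt
  set yt : Fin 3 → MvPolynomial (Fin (3 + 1)) O := fun t => ∑ j : Fin 3, C (Nt t j) * X (r j) with hyt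
  have hyt1 : ∀ t, yt t ∈ homogeneousSubmodule (Fin (3 + 1)) O 1 := fun t =>
    (mem_homogeneousSubmodule _ _).mpr (HyperplaneAlg.isHomogeneous_sum_C_mul_X _ _)
  have hLt1 : Lt ∈ homogeneousSubmodule (Fin (3 + 1)) O 1 := (mem_homogeneousSubmodule _ _).mpr (HyperplaneAlg.isHomogeneous_sum_C_mul_X ct id)
  have hm1 : ∀ t : Fin 3, yt t - C (nO i t) * yt 2 ∈ homogeneousSubmodule (Fin (3 + 1)) O 1 := fun t =>
    (mem_homogeneousSubmodule _ _).mpr ((HyperplaneAlg.isHomogeneous_sum_C_mul_X _ _).sub ((HyperplaneAlg.isHomogeneous_sum_C_mul_X _ _).C_mul _))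
  have hGe : aeval yt Gt ∈ homogeneousSubmodule (Fin (3 + 1)) O e := by simpa using hF 1
  -- the scalars and the hyperplane coordinates in the stalk at the node
  set c₀ : O →+* HomogeneousLocalization.Away (homogeneousSubmodule (Fin (3 + 1)) O) (X (dv i) : MvPolynomial (Fin (3 + 1)) O) :=
    (HomogeneousLocalization.fromZeroRingHom (homogeneousSubmodule (Fin (3 + 1)) O) (Submonoid.powers (X (dv i) : MvPolynomial (Fin (3 + 1)) O))).comp
      (algebraMap O (homogeneousSubmodule (Fin (3 + 1)) O 0)) with hc₀
  set yB : Fin 3 → (Proj (homogeneousSubmodule (Fin (3 + 1)) O)).presheaf.stalk (S p) :=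
    fun t => Θ (mk₁ (homogeneousSubmodule (Fin (3 + 1)) O) (isHomogeneous_X O (dv i)) 1 (yt t) (hyt1 t)) with hyB
  -- `y₂/x_d` is a unit at the node
  have hwB : IsUnit (yB 2) := by
    have hst : (S.stalkMap p) (yB 2) = StructureSheaf.toStalk O p (MvPolynomial.eval (av i) (yt 2)) :=
      SectionOfVec.stalkMap_germ_awayToSection (av i) (dv i) (hav i) p (yt 2) (hyt1 2)
    have hunit2 : IsUnit (MvPolynomial.eval (av i) (yt 2)) := by
      refine IsUnit.of_mul_eq_one_right u₀ ?_
      rw [SectionFrame.mul_eval_sect Bt Nt r (nO i) (av i) u₀ huav hsect 2, hnO2 i]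
    have h2 : IsUnit ((S.stalkMap p).hom (yB 2)) := by
      change IsUnit ((S.stalkMap p) (yB 2)); rw [hst]; exact hunit2.map _
    exact isUnit_of_map_unit (S.stalkMap p).hom _ h2
  -- the node chart data and the Taylor expansion in the stalk at the node
  obtain ⟨h00, h10, h01, hdq⟩ := nodeChart_hypotheses Gt (nO i) (hnO2 i) (hnode i).1 ((hnode i).2 0) ((hnode i).2 1) (hhess i)
  set u := yB 0 - (Θ.comp c₀) (nO i 0) * yB 2 with hudef
  set vv := yB 1 - (Θ.comp c₀) (nO i 1) * yB 2 with hvdef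
  obtain ⟨Aq, Bq, Cq, h, hgeq, hh, hdisc⟩ := SectionOfVec.node_taylor_eval₂ (Θ.comp c₀) Gt hGt (nO i) h00 h10 h01 hdq yB hwB
  have hum : ∀ t : Fin 3, Θ (mk₁ (homogeneousSubmodule (Fin (3 + 1)) O) (isHomogeneous_X O (dv i)) 1 (yt t - C (nO i t) * yt 2) (hm1 t)) =
      yB t - (Θ.comp c₀) (nO i t) * yB 2 := by
    intro t
    have ha : aeval yt (X t - C (nO i t) * X 2 : MvPolynomial (Fin 3) O) = yt t - C (nO i t) * yt 2 := by
      rw [map_sub, map_mul, aeval_X, aeval_X, aeval_C, MvPolynomial.algebraMap_eq]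
    have hmem : aeval yt (X t - C (nO i t) * X 2 : MvPolynomial (Fin 3) O) ∈ homogeneousSubmodule (Fin (3 + 1)) O 1 := by rw [ha]; exact hm1 t
    rw [← mk₁_congr (homogeneousSubmodule (Fin (3 + 1)) O) (isHomogeneous_X O (dv i)) ha hmem (hm1 t),
      SectionOfVec.mk₁_aeval_linear_eq_eval₂ (dv i) yt hyt1 _ (((isHomogeneous_X O t).sub ((isHomogeneous_X O 2).C_mul _))) hmem,
      MvPolynomial.eval₂_comp_left Θ c₀]
    simp only [eval₂_sub, eval₂_mul, eval₂_X, eval₂_C, Function.comp_apply, hyB]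
  have hgerm : Θ (mk₁ (homogeneousSubmodule (Fin (3 + 1)) O) (isHomogeneous_X O (dv i)) e (aeval yt Gt) hGe) = eval₂ (Θ.comp c₀) yB Gt := by
    rw [SectionOfVec.mk₁_aeval_linear_eq_eval₂ (dv i) yt hyt1 Gt hGt hGe, MvPolynomial.eval₂_comp_left Θ c₀]
    rfl
  -- STALKS OF THE THREE IDEAL SHEAVES at the node, through the chart `D₊(x_d)` (as in ✓ `coreS8_splitNode`)
  have hrange2 : ∀ (f : Fin 2 → (Proj (homogeneousSubmodule (Fin (3 + 1)) O)).presheaf.stalk (S p)),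
      Ideal.span (Set.range f) = Ideal.span {f 0} ⊔ Ideal.span {f 1} := by
    intro f; rw [← Ideal.span_union]; congr 1; ext z; constructor
    · rintro ⟨l, rfl⟩; fin_cases l <;> simp
    · rintro (rfl | rfl) <;> exact ⟨_, rfl⟩
  have hrange3 : ∀ (f : Fin 3 → (Proj (homogeneousSubmodule (Fin (3 + 1)) O)).presheaf.stalk (S p)),
      Ideal.span (Set.range f) = Ideal.span {f 0} ⊔ Ideal.span {f 1, f 2} := by
    intro f; rw [← Ideal.span_union]; congr 1; ext z; constructor
    · rintro ⟨l, rfl⟩; fin_cases l <;> simp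
    · rintro (rfl | rfl | rfl) <;> exact ⟨_, rfl⟩
  have hFr : ∀ l, (![Lt, yt 0 - C (nO i 0) * yt 2, yt 1 - C (nO i 1) * yt 2] : Fin 3 → MvPolynomial (Fin (3 + 1)) O) l ∈
      homogeneousSubmodule (Fin (3 + 1)) O ((fun _ => 1 : Fin 3 → ℕ) l) := by
    intro l; fin_cases l
    · exact hLt1
    · exact hm1 0
    · exact hm1 1
  have hfr := SectionFrame.span_X_sub_eq_span_frame Bt ct Nt r a₀ hcta₀ hψt hsect hkert (nO i) (hnO2 i) (av i) (dv i) (hav i) u₀ hu₀ huav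
  -- names for the three germs at the node
  set ℓA := Θ (mk₁ (homogeneousSubmodule (Fin (3 + 1)) O) (isHomogeneous_X O (dv i)) 1 Lt hLt1) with hℓA
  set gA := Θ (mk₁ (homogeneousSubmodule (Fin (3 + 1)) O) (isHomogeneous_X O (dv i)) e (aeval yt Gt) hGe) with hgA
  have hK : stalkIdeal S.ker (S p) = Ideal.span {ℓA} ⊔ Ideal.span {u, vv} := by
    rw [SectionOfVec.stalkIdeal_ker_sectionOfVec_eq (av i) (dv i) (hav i) hci]
    have hN : (⟨Ideal.span (Set.range fun j : Fin (3 + 1) => (X j - C (av i j) * X (dv i) : MvPolynomial (Fin (3 + 1)) O)),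
        isHomogeneous_span_of_forall_mem _ _ (fun _ => 1) (SectionOfVec.X_sub_C_mul_X_mem_one (av i) (dv i))⟩ :
          HomogeneousIdeal (homogeneousSubmodule (Fin (3 + 1)) O)) =
        ⟨Ideal.span (Set.range ![Lt, yt 0 - C (nO i 0) * yt 2, yt 1 - C (nO i 1) * yt 2]), isHomogeneous_span_of_forall_mem _ _ (fun _ => 1) hFr⟩ :=
      HomogeneousIdeal.ext hfr
    rw [hN, CILift.stalkIdeal_projIdealSheaf_span _ (fun _ => 1) hFr (dv i) (S p) hx, hrange3]
    have e0 : mk₁ (homogeneousSubmodule (Fin (3 + 1)) O) (isHomogeneous_X O (dv i)) 1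
        ((![Lt, yt 0 - C (nO i 0) * yt 2, yt 1 - C (nO i 1) * yt 2] : Fin 3 → MvPolynomial (Fin (3 + 1)) O) 0) (hFr 0) =
        mk₁ (homogeneousSubmodule (Fin (3 + 1)) O) (isHomogeneous_X O (dv i)) 1 Lt hLt1 := rfl
    have e1 : mk₁ (homogeneousSubmodule (Fin (3 + 1)) O) (isHomogeneous_X O (dv i)) 1
        ((![Lt, yt 0 - C (nO i 0) * yt 2, yt 1 - C (nO i 1) * yt 2] : Fin 3 → MvPolynomial (Fin (3 + 1)) O) 1) (hFr 1) =
        mk₁ (homogeneousSubmodule (Fin (3 + 1)) O) (isHomogeneous_X O (dv i)) 1 (yt 0 - C (nO i 0) * yt 2) (hm1 0) :=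
      mk₁_congr _ _ (by simp) _ _
    have e2 : mk₁ (homogeneousSubmodule (Fin (3 + 1)) O) (isHomogeneous_X O (dv i)) 1
        ((![Lt, yt 0 - C (nO i 0) * yt 2, yt 1 - C (nO i 1) * yt 2] : Fin 3 → MvPolynomial (Fin (3 + 1)) O) 2) (hFr 2) =
        mk₁ (homogeneousSubmodule (Fin (3 + 1)) O) (isHomogeneous_X O (dv i)) 1 (yt 1 - C (nO i 1) * yt 2) (hm1 1) :=
      mk₁_congr _ _ (by simp) _ _
    rw [e0, e1, e2, hudef, hvdef, ← hum 0, ← hum 1]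
    rfl
  have hW : stalkIdeal (projIdealSheaf (homogeneousSubmodule (Fin (3 + 1)) O)
      ⟨Ideal.span (Set.range ![Lt, aeval yt Gt]), isHomogeneous_span_of_forall_mem _ _ _ hF⟩) (S p) =
      Ideal.span {ℓA} ⊔ Ideal.span {gA} := by
    rw [CILift.stalkIdeal_projIdealSheaf_span _ _ hF (dv i) (S p) hx, hrange2]
    have eW0 : mk₁ (homogeneousSubmodule (Fin (3 + 1)) O) (isHomogeneous_X O (dv i)) ((![1, e] : Fin 2 → ℕ) 0)
        ((![Lt, aeval yt Gt] : Fin 2 → MvPolynomial (Fin (3 + 1)) O) 0) (hF 0) =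
        mk₁ (homogeneousSubmodule (Fin (3 + 1)) O) (isHomogeneous_X O (dv i)) 1 Lt hLt1 := rfl
    have eW1 : mk₁ (homogeneousSubmodule (Fin (3 + 1)) O) (isHomogeneous_X O (dv i)) ((![1, e] : Fin 2 → ℕ) 1)
        ((![Lt, aeval yt Gt] : Fin 2 → MvPolynomial (Fin (3 + 1)) O) 1) (hF 1) =
        mk₁ (homogeneousSubmodule (Fin (3 + 1)) O) (isHomogeneous_X O (dv i)) e (aeval yt Gt) hGe := rfl
    rw [eW0, eW1]
    rfl
  -- ### the generization `y = ι x` and the specialisation map `sp : 𝒪_{P,node} → 𝒪_{P,y}`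
  have hyU : (projIdealSheaf (homogeneousSubmodule (Fin (3 + 1)) O) ⟨Ideal.span (Set.range ![Lt, aeval yt Gt]), isHomogeneous_span_of_forall_mem _ _ _ hF⟩).subschemeι x ∈ U := hsp.mem_open U.isOpen hx
  set sp : (Proj (homogeneousSubmodule (Fin (3 + 1)) O)).presheaf.stalk (S p) →+*
      (Proj (homogeneousSubmodule (Fin (3 + 1)) O)).presheaf.stalk ((projIdealSheaf (homogeneousSubmodule (Fin (3 + 1)) O) ⟨Ideal.span (Set.range ![Lt, aeval yt Gt]), isHomogeneous_span_of_forall_mem _ _ _ hF⟩).subschemeι x) :=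
    ((Proj (homogeneousSubmodule (Fin (3 + 1)) O)).presheaf.stalkSpecializes hsp).hom with hspdef
  letI algsp : Algebra ((Proj (homogeneousSubmodule (Fin (3 + 1)) O)).presheaf.stalk (S p))
      ((Proj (homogeneousSubmodule (Fin (3 + 1)) O)).presheaf.stalk ((projIdealSheaf (homogeneousSubmodule (Fin (3 + 1)) O) ⟨Ideal.span (Set.range ![Lt, aeval yt Gt]), isHomogeneous_span_of_forall_mem _ _ _ hF⟩).subschemeι x)) := sp.toAlgebra
  set 𝔭 : Ideal ((Proj (homogeneousSubmodule (Fin (3 + 1)) O)).presheaf.stalk (S p)) :=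
    (IsLocalRing.maximalIdeal _).comap sp with h𝔭
  haveI h𝔭prime : 𝔭.IsPrime := Ideal.comap_isPrime sp _
  haveI : IsLocalization.AtPrime ((Proj (homogeneousSubmodule (Fin (3 + 1)) O)).presheaf.stalk ((projIdealSheaf (homogeneousSubmodule (Fin (3 + 1)) O) ⟨Ideal.span (Set.range ![Lt, aeval yt Gt]), isHomogeneous_span_of_forall_mem _ _ _ hF⟩).subschemeι x)) 𝔭 :=
    Literature.AlgebraicGeometry.Resolution.isLocalizationAtPrime_stalkSpecializes hsp
  haveI : IsRegularLocalRing ((Proj (homogeneousSubmodule (Fin (3 + 1)) O)).presheaf.stalk ((projIdealSheaf (homogeneousSubmodule (Fin (3 + 1)) O) ⟨Ideal.span (Set.range ![Lt, aeval yt Gt]), isHomogeneous_span_of_forall_mem _ _ _ hF⟩).subschemeι x)) := hPreg _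
  have h𝔭mem : ∀ z, z ∈ 𝔭 ↔ sp z ∈ IsLocalRing.maximalIdeal _ := fun z => Iff.rfl
  -- ### the point `y = ι x`: membership facts
  have hysupp : (projIdealSheaf (homogeneousSubmodule (Fin (3 + 1)) O) ⟨Ideal.span (Set.range ![Lt, aeval yt Gt]), isHomogeneous_span_of_forall_mem _ _ _ hF⟩).subschemeι x ∈ (projIdealSheaf (homogeneousSubmodule (Fin (3 + 1)) O) ⟨Ideal.span (Set.range ![Lt, aeval yt Gt]), isHomogeneous_span_of_forall_mem _ _ _ hF⟩).support := by
    have hr := Set.mem_range_self (f := ⇑(ConcreteCategory.hom (projIdealSheaf (homogeneousSubmodule (Fin (3 + 1)) O) ⟨Ideal.span (Set.range ![Lt, aeval yt Gt]), isHomogeneous_span_of_forall_mem _ _ _ hF⟩).subschemeι.base)) x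
    rwa [Scheme.IdealSheafData.range_subschemeι] at hr
  have hWy : stalkIdeal (projIdealSheaf (homogeneousSubmodule (Fin (3 + 1)) O) ⟨Ideal.span (Set.range ![Lt, aeval yt Gt]), isHomogeneous_span_of_forall_mem _ _ _ hF⟩) ((projIdealSheaf (homogeneousSubmodule (Fin (3 + 1)) O) ⟨Ideal.span (Set.range ![Lt, aeval yt Gt]), isHomogeneous_span_of_forall_mem _ _ _ hF⟩).subschemeι x) = Ideal.span {sp ℓA, sp gA} := by
    rw [← Literature.AlgebraicGeometry.Resolution.stalkIdeal_map_stalkSpecializes _ hsp, ← hspdef, hW, Ideal.map_sup, Ideal.map_span,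
      Ideal.map_span, Set.image_singleton, Set.image_singleton, Ideal.span_insert]
  have hWyle : stalkIdeal (projIdealSheaf (homogeneousSubmodule (Fin (3 + 1)) O) ⟨Ideal.span (Set.range ![Lt, aeval yt Gt]), isHomogeneous_span_of_forall_mem _ _ _ hF⟩) ((projIdealSheaf (homogeneousSubmodule (Fin (3 + 1)) O) ⟨Ideal.span (Set.range ![Lt, aeval yt Gt]), isHomogeneous_span_of_forall_mem _ _ _ hF⟩).subschemeι x) ≤ IsLocalRing.maximalIdeal _ :=
    (Literature.AlgebraicGeometry.Resolution.mem_support_iff_stalkIdeal_le _ _).mp hysupp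
  have hℓ𝔭 : ℓA ∈ 𝔭 := (h𝔭mem _).mpr (hWyle (by rw [hWy]; exact Ideal.subset_span (Set.mem_insert _ _)))
  have hg𝔭 : gA ∈ 𝔭 := (h𝔭mem _).mpr (hWyle (by rw [hWy]; exact Ideal.subset_span (Set.mem_insert_of_mem _ (Set.mem_singleton _))))
  -- the node point lies on the section: `u, v ∈ 𝔪_node`
  have hx₀supp : S p ∈ S.ker.support := S.range_subset_ker_support ⟨p, rfl⟩
  have hKle : stalkIdeal S.ker (S p) ≤ IsLocalRing.maximalIdeal _ :=
    (Literature.AlgebraicGeometry.Resolution.mem_support_iff_stalkIdeal_le _ _).mp hx₀supp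
  have huA : u ∈ IsLocalRing.maximalIdeal _ := hKle (by rw [hK]; exact Ideal.mem_sup_right (Ideal.subset_span (Set.mem_insert _ _)))
  have hvA : vv ∈ IsLocalRing.maximalIdeal _ :=
    hKle (by rw [hK]; exact Ideal.mem_sup_right (Ideal.subset_span (Set.mem_insert_of_mem _ (Set.mem_singleton _))))
  have h𝔭le : 𝔭 ≤ IsLocalRing.maximalIdeal _ := IsLocalRing.le_maximalIdeal (Ideal.IsPrime.ne_top h𝔭prime)
  -- OFF THE SECTION: not both `u, v` lie in `𝔭` (else `y ∈ supp (ker 𝔰ᵢ) = range 𝔰ᵢ`)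
  have hsec : ¬ (u ∈ 𝔭 ∧ vv ∈ 𝔭) := by
    rintro ⟨hu𝔭, hv𝔭⟩
    apply hoff
    have hle : stalkIdeal S.ker ((projIdealSheaf (homogeneousSubmodule (Fin (3 + 1)) O) ⟨Ideal.span (Set.range ![Lt, aeval yt Gt]), isHomogeneous_span_of_forall_mem _ _ _ hF⟩).subschemeι x) ≤ IsLocalRing.maximalIdeal _ := by
      rw [← Literature.AlgebraicGeometry.Resolution.stalkIdeal_map_stalkSpecializes _ hsp, ← hspdef, hK, Ideal.map_le_iff_le_comap]
      refine sup_le ?_ ?_ <;> rw [Ideal.span_le]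
      · intro z hz; rw [Set.mem_singleton_iff.mp hz]; exact hℓ𝔭
      · intro z hz
        rcases hz with hz | hz
        · rw [hz]; exact hu𝔭
        · rw [Set.mem_singleton_iff.mp hz]; exact hv𝔭
    have hmem : (projIdealSheaf (homogeneousSubmodule (Fin (3 + 1)) O) ⟨Ideal.span (Set.range ![Lt, aeval yt Gt]), isHomogeneous_span_of_forall_mem _ _ _ hF⟩).subschemeι x ∈ (S.ker.support : Set (Proj (homogeneousSubmodule (Fin (3 + 1)) O))) :=
      (Literature.AlgebraicGeometry.Resolution.mem_support_iff_stalkIdeal_le _ _).mpr hle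
    rw [Scheme.Hom.support_ker, (S.isClosedEmbedding.isClosed_range).closure_eq] at hmem
    exact hmem
  -- ### the chart ring `T = O[t₁,t₂,t₃] ≅ (O[x]_{x_d})₀` and the DUAL DERIVATIONS of the affine frame (✓ `exists_chart_frame_dual_derivations`)
  set e₀ := Literature.AlgebraicGeometry.Motives.ProjectiveSpace.chartAlgEquiv O (dv i) (n := 3) with he₀def
  obtain ⟨E, hE⟩ := exists_chart_frame_dual_derivations k O θ hθ φ hφ' hφ hPint hPnoeth hPreg hqprop hqsm ℓ Z hZ e δ g B c a b v r hg hsqf hZeq hℓB hr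
    hcab hmarked hcover hvinj a₀ Bt ct Nt ha₀ hBt hdet hcta₀ hψt hsect hkert hVℓ Gt nO hGt hGtred hnOv hnO2 hnode hhess hL hF av dv hav hunit 𝔰 h𝔰 w hw i hFr
  have hE' : ∀ j l, E j (e₀ (mk₁ (homogeneousSubmodule (Fin (3 + 1)) O) (isHomogeneous_X O (dv i)) 1
      ((![Lt, yt 0 - C (nO i 0) * yt 2, yt 1 - C (nO i 1) * yt 2] : Fin 3 → MvPolynomial (Fin (3 + 1)) O) l) (hFr l))) = if j = l then 1 else 0 :=
    fun j l => by rw [he₀def]; exact hE j l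
  -- ### `𝒪_{P,node}` is a localisation of `Γ(P, D₊(x_d)) ≅ T`: extend the dual derivations to the node stalk
  have hU' : IsAffineOpen U := Proj.isAffineOpen_basicOpen _ (X (dv i) : MvPolynomial (Fin (3 + 1)) O) (isHomogeneous_X O (dv i)) one_pos
  letI algΓ : Algebra Γ(Proj (homogeneousSubmodule (Fin (3 + 1)) O), U) ((Proj (homogeneousSubmodule (Fin (3 + 1)) O)).presheaf.stalk (S p)) :=
    (Proj (homogeneousSubmodule (Fin (3 + 1)) O)).presheaf.algebra_section_stalk (⟨S p, hx⟩ : U)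
  haveI locA : IsLocalization.AtPrime ((Proj (homogeneousSubmodule (Fin (3 + 1)) O)).presheaf.stalk (S p)) (hU'.primeIdealOf ⟨S p, hx⟩).asIdeal :=
    hU'.isLocalization_stalk ⟨S p, hx⟩
  obtain ⟨hΓ, hΓdef⟩ : ∃ hΓ : Γ(Proj (homogeneousSubmodule (Fin (3 + 1)) O), U) ≃+* MvPolynomial (Fin 3) O, hΓ =
    ((Proj.basicOpenIsoAway (homogeneousSubmodule (Fin (3 + 1)) O) (X (dv i) : MvPolynomial (Fin (3 + 1)) O) (isHomogeneous_X O (dv i)) one_pos).commRingCatIsoToRingEquiv.symm).trans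
      e₀.toRingEquiv := ⟨_, rfl⟩
  have halgΓ : ∀ z : MvPolynomial (Fin 3) O,
      algebraMap Γ(Proj (homogeneousSubmodule (Fin (3 + 1)) O), U) ((Proj (homogeneousSubmodule (Fin (3 + 1)) O)).presheaf.stalk (S p)) (hΓ.symm z) = Θ (e₀.symm z) := by
    intro z
    rw [hΓdef]
    change ((Proj (homogeneousSubmodule (Fin (3 + 1)) O)).presheaf.germ U (S p) hx).hom
      ((Proj.basicOpenIsoAway (homogeneousSubmodule (Fin (3 + 1)) O) (X (dv i) : MvPolynomial (Fin (3 + 1)) O) (isHomogeneous_X O (dv i)) one_pos).hom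
        (e₀.symm z)) = _
    rw [Proj.basicOpenIsoAway_hom]
    rfl
  have hext : ∀ j, ∃ δ : Derivation ℤ ((Proj (homogeneousSubmodule (Fin (3 + 1)) O)).presheaf.stalk (S p)) ((Proj (homogeneousSubmodule (Fin (3 + 1)) O)).presheaf.stalk (S p)),
      ∀ z : MvPolynomial (Fin 3) O, δ (Θ (e₀.symm z)) = Θ (e₀.symm (E j z)) := by
    intro j
    obtain ⟨δ, hδ⟩ := exists_derivation_extend_of_ringEquiv_of_isLocalization (A := (Proj (homogeneousSubmodule (Fin (3 + 1)) O)).presheaf.stalk (S p))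
      (hU'.primeIdealOf ⟨S p, hx⟩).asIdeal.primeCompl hΓ (E j)
    refine ⟨δ, fun z => ?_⟩
    rw [← halgΓ, ← halgΓ]
    exact hδ z
  choose δ hδ using hext
  -- dual values on the frame germs
  have hdual : ∀ j l, δ j (Θ (mk₁ (homogeneousSubmodule (Fin (3 + 1)) O) (isHomogeneous_X O (dv i)) 1
      ((![Lt, yt 0 - C (nO i 0) * yt 2, yt 1 - C (nO i 1) * yt 2] : Fin 3 → MvPolynomial (Fin (3 + 1)) O) l) (hFr l))) = if j = l then 1 else 0 := by
    intro j l
    have h1 := hδ j (e₀ (mk₁ (homogeneousSubmodule (Fin (3 + 1)) O) (isHomogeneous_X O (dv i)) 1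
      ((![Lt, yt 0 - C (nO i 0) * yt 2, yt 1 - C (nO i 1) * yt 2] : Fin 3 → MvPolynomial (Fin (3 + 1)) O) l) (hFr l)))
    rw [e₀.symm_apply_apply, hE' j l] at h1
    rw [h1]
    split_ifs
    · exact (congrArg Θ (map_one e₀.symm)).trans (map_one Θ)
    · exact (congrArg Θ (map_zero e₀.symm)).trans (map_zero Θ)
  have hfr0 : ℓA = Θ (mk₁ (homogeneousSubmodule (Fin (3 + 1)) O) (isHomogeneous_X O (dv i)) 1
      ((![Lt, yt 0 - C (nO i 0) * yt 2, yt 1 - C (nO i 1) * yt 2] : Fin 3 → MvPolynomial (Fin (3 + 1)) O) 0) (hFr 0)) := rfl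
  have hfr1 : u = Θ (mk₁ (homogeneousSubmodule (Fin (3 + 1)) O) (isHomogeneous_X O (dv i)) 1
      ((![Lt, yt 0 - C (nO i 0) * yt 2, yt 1 - C (nO i 1) * yt 2] : Fin 3 → MvPolynomial (Fin (3 + 1)) O) 1) (hFr 1)) := by
    rw [hudef, ← hum 0]; rfl
  have hfr2 : vv = Θ (mk₁ (homogeneousSubmodule (Fin (3 + 1)) O) (isHomogeneous_X O (dv i)) 1
      ((![Lt, yt 0 - C (nO i 0) * yt 2, yt 1 - C (nO i 1) * yt 2] : Fin 3 → MvPolynomial (Fin (3 + 1)) O) 2) (hFr 2)) := by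
    rw [hvdef, ← hum 1]; rfl
  -- ### THE NODE OFF THE SECTION: ✓ `NodeReg.node_deriv_not_mem` in `𝒪_{P,node}`
  have hgexpr : gA = Aq * u ^ 2 + Bq * u * vv + Cq * vv ^ 2 + h := by rw [hudef, hvdef, ← hgeq, ← hgerm]
  have hg𝔭' : Aq * u ^ 2 + Bq * u * vv + Cq * vv ^ 2 + h ∈ 𝔭 := hgexpr ▸ hg𝔭
  have h1u : δ 1 u = 1 := by rw [hfr1, hdual]; simp
  have h1v : δ 1 vv = 0 := by rw [hfr2, hdual]; simp
  have h2u : δ 2 u = 0 := by rw [hfr1, hdual]; simp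
  have h2v : δ 2 vv = 1 := by rw [hfr2, hdual]; simp
  have h0ℓ : δ 0 ℓA = 1 := by rw [hfr0, hdual]; simp
  have h1ℓ : δ 1 ℓA = 0 := by rw [hfr0, hdual]; simp
  have h2ℓ : δ 2 ℓA = 0 := by rw [hfr0, hdual]; simp
  have hnd := NodeReg.node_deriv_not_mem (δ 1) (δ 2) u vv Aq Bq Cq h h1u h1v h2u h2v hh hdisc
    (𝔪 := IsLocalRing.maximalIdeal _) (𝔭 := 𝔭) huA hvA h𝔭le hsec
  have h1n : (1 : (Proj (homogeneousSubmodule (Fin (3 + 1)) O)).presheaf.stalk (S p)) ∉ 𝔭 := fun h1 =>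
    (Ideal.IsPrime.ne_top h𝔭prime) ((Ideal.eq_top_iff_one _).mpr h1)
  -- ### THE RANK-2 JACOBIAN CRITERION in `𝒪_{P,y}` (✓ 027 `NodeReg.isRegularLocalRing_quotient_pair_of_derivations`)
  have hreg : IsRegularLocalRing ((Proj (homogeneousSubmodule (Fin (3 + 1)) O)).presheaf.stalk ((projIdealSheaf (homogeneousSubmodule (Fin (3 + 1)) O) ⟨Ideal.span (Set.range ![Lt, aeval yt Gt]), isHomogeneous_span_of_forall_mem _ _ _ hF⟩).subschemeι x) ⧸
      Ideal.span {algebraMap _ ((Proj (homogeneousSubmodule (Fin (3 + 1)) O)).presheaf.stalk ((projIdealSheaf (homogeneousSubmodule (Fin (3 + 1)) O) ⟨Ideal.span (Set.range ![Lt, aeval yt Gt]), isHomogeneous_span_of_forall_mem _ _ _ hF⟩).subschemeι x)) ℓA,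
        algebraMap _ ((Proj (homogeneousSubmodule (Fin (3 + 1)) O)).presheaf.stalk ((projIdealSheaf (homogeneousSubmodule (Fin (3 + 1)) O) ⟨Ideal.span (Set.range ![Lt, aeval yt Gt]), isHomogeneous_span_of_forall_mem _ _ _ hF⟩).subschemeι x)) (Aq * u ^ 2 + Bq * u * vv + Cq * vv ^ 2 + h)}) := by
    rcases hnd with hn1 | hn2
    · exact NodeReg.isRegularLocalRing_quotient_pair_of_derivations 𝔭 (δ 0) (δ 1) hℓ𝔭 hg𝔭' (by rw [h0ℓ]; exact h1n)
        (by rw [h1ℓ]; exact zero_mem _) hn1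
    · exact NodeReg.isRegularLocalRing_quotient_pair_of_derivations 𝔭 (δ 0) (δ 2) hℓ𝔭 hg𝔭' (by rw [h0ℓ]; exact h1n)
        (by rw [h2ℓ]; exact zero_mem _) hn2
  -- ### conclusion: `𝒪_{V(𝓦₀),x} ≅ 𝒪_{P,y} ⧸ (𝓦₀)_y = 𝒪_{P,y} ⧸ (ℓ, g)`
  rw [isRegularLocalRing_subscheme_stalk_iff_of_eq (projIdealSheaf (homogeneousSubmodule (Fin (3 + 1)) O) ⟨Ideal.span (Set.range ![Lt, aeval yt Gt]), isHomogeneous_span_of_forall_mem _ _ _ hF⟩) x _ rfl, hWy, hgexpr]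
  exact hreg

end Summit.ResolutionOfSingularities.ResolutionOfSingularities.Cruxes.EquisingularLiftNat.Sections.Equinodal

end
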